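import Literature.NumberTheory.EllipticCurves.CastellaGrossiLeeSkinner2022.HeegnerPointKolyvaginSystem
import HarnessLib

/-!
# Castella–Grossi–Skinner 2025, Theorem 6.5.1: the `Λ`-adic Kolyvagin-system bound for `E_K` —
# «(h1) and a Kolyvagin system `κ ∈ 𝐊𝐒(𝐓, 𝓕_Λ, 𝓛_E)` with `κ₁ ≠ 0` ⇒ `𝔖_ord` of `Λ`-rank one,
# `𝔛_ord ∼ Λ ⊕ M ⊕ M`, `char_Λ(M) ∣ char_Λ(𝔖_ord/Λκ₁)` in `Λ[1/p]`» — ONE cite-only named fact, (disc)-free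
# and (Heeg)-free as printed

Topic `NumberTheory/EllipticCurves/CastellaGrossiSkinner2025` (cell `pub/bsd-print-x9`, literature seat g45;
served on x10b-p2 LEAD g12's line «→ lit: type CGS25 Thm 6.5.1» 2026-08-29T05:19:22Z / 05:20:00Z, DOSSIER §74).
Sibling of `HeegnerKolyvaginBoundAnyClassNumber.lean` (Thm. 6.5.2 = THIS theorem applied to «the Kolyvagin system
`κ^{Hg}` of [CGLS22, Thm. 4.1.1]», typed there over the record `Thm413Hypotheses`, which carries CGLS22 §4.1's
(Heeg) and (disc) because `κ^{Hg}` is built under them).  Theorem 6.5.1 itself — the ABSTRACT Kolyvagin-system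
theorem — is printed WITHOUT (Heeg) and WITHOUT (disc): its only hypotheses are the §6 standing ones, (h1), and
the Kolyvagin system.  It is typed here over the SAME `Λ`-adic source setting `S_Λ = (𝐓, 𝓕_Λ, 𝓛_E)` as CGLS22's
Thm. 4.1.1 (`thm651Setting` = the body of `CastellaGrossiLeeSkinner2022.thm411Setting` with the record field
`hyp.level` replaced by a bare binder `hN : N = N_E`, so that `thm411Setting … hyp … = thm651Setting … hyp.level …`
holds by `rfl`: a Kolyvagin system for the one IS a Kolyvagin system for the other).  A separate file rather than
an append: the Thm. 6.5.2 file has many importers in the cell's cone and a docstring-free statement append would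
rebuild them all; this file has none.  ONE named fact (`def … : Prop`, D-0014; nothing asserted; debt +1, cite-only
print leaf by design of the print tier), one definition with a body (`thm651Setting`), one `rfl` lemma.
HONEST FRAMING: typed ≠ proved ≠ endorsed; nothing here moves a class; BSD is not proved by any of this.

F. Castella, G. Grossi, C. Skinner, *Mazur's main conjecture at Eisenstein primes*, Math. Ann. **393** (2025)
2451–2506 = arXiv:2303.04373 [CastellaGrossiSkinner2025]; REFEREED / PUBLISHED.  Text of record: the authors' final
TeX `Mazur-paper_revised.tex` (locators `[l.nnnn]`, published numbering §6 / Thm. 6.5.1) as quoted in the sibling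
file's header; store copy `paper:arxiv-2303.04373` = v1 (v1 §5 / Thm. 5.5.1, page locators `[p00NN:Lnn]`).

## The printed statements, verbatim

* **§6 standing** [l.2259–2262; v1 §5, p0020 L10–L13]: "let `E/ℚ` be an elliptic curve of conductor `N`,
  `p ∤ 2N` be a prime of good ordinary reduction for `E`, and `K` be an imaginary quadratic field of discriminant
  `D_K` prime to `Np`. We assume (h1) `E(K)[p] = 0`, and denote by `𝓛 = 𝓛_E` the set of primes `ℓ ∤ N` that are
  inert in `K` and satisfy `a_ℓ ≡ ℓ + 1 ≡ 0 (mod p)` …, and by `𝒩` the set of square-free products of primes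
  `ℓ ∈ 𝓛`" [v1 p0020 L15–L16].  `Λ = Λ_K⁻` is the anticyclotomic Iwasawa algebra, `K_∞⁻/K` the anticyclotomic
  `ℤ_p`-extension [v1 p0004 L1–L16; §6.5 l.3203 "Let `Λ = Λ_K⁻`"].
* **§6.1** [v1 p0020 L57–L60]: "We refer the reader to [CGLS22, §3.1] for the definition of the module of
  Kolyvagin systems `𝐊𝐒(T, 𝓕_ord, 𝓛)` associated to the triple `(T, 𝓕_ord, 𝓛)`".
* **§6.5 identifications** [l.3203–3211; v1 p0026 L20–L25]: "the modules `𝒳 = H¹_{𝓕_Λ}(K, M_E)^∨`,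
  `H¹_{𝓕_Λ}(K, 𝐓)` in [CGLS22] are the same as the modules `𝔛_ord(E/K_∞⁻)` and `𝔖_ord(E/K_∞⁻)` in §3.1,
  respectively."
* **Theorem 6.5.1** (`thm:howard`) [l.3213–3220; v1 Thm. 5.5.1, p0026 L27–L31], verbatim: "Assume `E(K)[p] = 0`
  and suppose there is a Kolyvagin system `κ ∈ 𝐊𝐒(𝐓, 𝓕_Λ, 𝓛_E)` with `κ₁ ≠ 0`. Then `𝔖_ord(E/K_∞⁻)` has
  `Λ`-rank one, and there is a finitely generated torsion `Λ`-module `M` such that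
  (i) `𝔛_ord(E/K_∞⁻) ∼ Λ ⊕ M ⊕ M`, (ii) `char_Λ(M)` divides `char_Λ(𝔖_ord(E/K_∞⁻)/Λκ₁)` in `Λ[1/p]`."
  Proof [l.3221–3227; v1 p0026 L33–L40]: "The proof is the same as that for [CGLS22, Thm. 3.4.1]. However, the
  prime ideal `(γ⁻ - 1) ⊂ Λ` was excluded from the analysis in loc. cit. … Replacing the appeal to op. cit. with
  one to Theorem 6.1.1 for the case of the prime `(γ⁻ - 1)`, yields the theorem."
* NO hypothesis (Heeg), (disc), (spl), on the class number of `K`, on the image of `E[p]` beyond (h1), or on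
  the Selmer corank appears in the §6 standing or in Theorem 6.5.1 ([CGLS22] §3, whose Thm. 3.4.1 it extends,
  stands under §3.2's «`p ∤ 2N` good ordinary, `D_K` prime to `Np`, (h1)» alone, arXiv:2008.02571v2 TeX
  L1253–1262; (Heeg)/(disc) enter [CGLS22] only at §4.1, L2186).  The downstream Theorem 6.5.2 inherits
  (Heeg)/(disc) from the construction of `κ^{Hg}` (sibling file; cell DOSSIER §74).

## Transcription (print-exact where the tree has the vocabulary; WEAKER, never stronger, elsewhere)

* `(𝐓, 𝓕_Λ, 𝓛_E)` is `thm651Setting` = A2's `WeierstrassCurve.shapiroSettingTame` for `E_K` at the twist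
  `κ.unitTwist (-1)` (`Ψ⁻¹`, [CGLS22] §3.4 L2083–2108), bad set `S = {v ∣ pN}` (`placesDividing`,
  `Σ(𝓕_Λ) = ∞ ∪ S`), `𝓛_E = 𝓛₁(𝐓) ∖ S` (`heegnerKolyvaginPrimes`: «`ℓ ∤ N` inert, `a_ℓ ≡ ℓ+1 ≡ 0 (mod p)`»,
  the `∖ S` being print's «`ℓ ∤ N`» / «`𝓛 ∩ Σ(𝓕) = ∅`») — token for token the body of
  `CastellaGrossiLeeSkinner2022.thm411Setting`, which reads the record `Thm413Hypotheses` ONLY through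
  `hyp.level : N = N_E`; here that equation is the bare binder `hN` (`thm411Setting_eq_thm651Setting`, `rfl`).
* `κ ∈ 𝐊𝐒(𝐓, 𝓕_Λ, 𝓛_E)` is `κKS : (thm651Setting …).KolyvaginSystem` (lit's `CoeffTowerSetting.KolyvaginSystem` =
  Howard Def. 1.2.3 in tower form), `κ₁ ≠ 0` is `κKS.one ≠ 0`; the presentation slots `π` (tame pins), the guard
  `P, hP`, `cd`, `πbar`, `Dsrc`, `jbar` are universally quantified exactly as in the Thm. 4.1.1 fact, and the guard
  is required to contain the level pairs `λ ∈ n ∈ 𝓝(𝓛_E)` (`_hPlev`) — there the finite–singular slots ARE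
  Howard's comparison isomorphisms (`thm411Setting_fsAdmissible`), so «Kolyvagin system» in the HYPOTHESIS is
  print's notion and the implication is not stronger than print.
* `𝔖_ord(E/K_∞⁻)` is a `Λ`-adic Selmer datum `D` (`D.S ≃ lim← S_p(E/K_k)`, `LambdaAdicSelmerData`) and
  `𝔛_ord(E/K_∞⁻)` a Selmer-dual datum `X` (`SelmerDualData`) — the currency of the sibling Thm. 6.5.2 fact and of
  [CGLS22] Thm. 4.1.3's; `κ₁ ∈ 𝔖_ord = H¹_{𝓕_Λ}(K, 𝐓)` (§6.5 identification) is recorded as an element `z : D.S`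
  on the SAME `Λ`-LINE as `κKS.one` under x9-p2's Shapiro comparison `Φ′ = toShapiroSuccLimitH1 : 𝔖 → lim_j H¹(K, 𝐓_j)`
  (Howard Def. 2.2.3): hypotheses `∃ a, κKS.one = a • Φ′(z)` and `∃ b, Φ′(z) = b • κKS.one` (`• = smulFamily`) —
  the two clauses of the Thm. 4.1.1 fact, verbatim; so `Λκ₁` is `Λ ∙ z` and `𝔖_ord/Λκ₁` is `D.S ⧸ Λ ∙ z`.
* Conclusion, through invariants of the printed pseudo-isomorphism exactly as in the sibling fact (WEAKER than
  print, never stronger): `D.S` and `X.X` finitely generated of `Λ`-rank one; `∃ J (= char_Λ(M)) m`,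
  `char_Λ(X_{Λ-tors}) = J²` ((i)) and `J ∣ (p^m) · char_Λ(D.S ⧸ Λ ∙ z)` ((ii), «divides in `Λ[1/p]`» rendered as
  divisibility up to a power of the principal ideal `(p)`, `Λ` a UFD — the sibling's convention).
* R2-G44 audit: every printed hypothesis is a binder — conductor `N` (`hN`), `p ≠ 2` and good ordinary at `p`
  (`_hp2`, `_hord`; `IsOrdinaryAt` = good reduction at `p ∧ p ∤ a_p`), `K` imaginary quadratic (`_hK`), `D_K` prime
  to `Np` (`_hD`), (h1) (`hE`), `K_∞⁻` anticyclotomic with topological generator `γ` (`_hac`, `hγ`), the Kolyvagin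
  system with `κ₁ ≠ 0`; nothing dropped; the only additions are the presentation slots / guard / same-line
  clauses above (tree artefacts shared with the Thm. 4.1.1 and 6.5.2 facts).  Binders the body does not read are
  `_`-prefixed.
* PROVENANCE (annotation, not a reliability reservation): printed proof = [CGLS22] §3 (Thm. 3.4.1 and its inputs)
  + CGS25 Thm. 6.1.1 at the prime `(γ⁻ - 1)`; no Heegner points, no Cornut–Vatsal, no Beilinson–Flach classes.
NOT typed (D-0026; no consumer named): Thm. 6.1.1 (`thm:Zp-twisted`), [CGLS22] Thm. 3.4.1 / Cor. 3.4.2 separately.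

References: [CastellaGrossiSkinner2025] §6 standing (final TeX l.2259–2262), §6.1 (v1 p0020 L50–L60), §6.5
(l.3201–3211), Thm. 6.5.1 (l.3213–3227) — v1 numbering §5, Thm. 5.5.1 (`paper:arxiv-2303.04373` p0020, p0026);
[CastellaGrossiLeeSkinner2022] §3.1–§3.4 and Thm. 3.4.1 (arXiv:2008.02571v2 TeX L1225–1311, L2083–2108),
§3.2 standing (L1253–1262); [Howard2004HeegnerKolyvagin] Def. 1.2.3, §2.2 Def. 2.2.3–2.2.6 (arXiv:1202.6340
pp. 6–7, p0016).
-/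

noncomputable section

open Function NumberField IsDedekindDomain Field IsLocalRing
open scoped NumberField ContRepresentation TensorProduct Classical

namespace Literature.NumberTheory.EllipticCurves.CastellaGrossiSkinner2025

open WeierstrassCurve Literature.NumberTheory.EllipticCurves Literature.NumberTheory.EllipticCurves.ZpExtension
open Literature.NumberTheory.GaloisRepresentations Literature.NumberTheory.GaloisRepresentations.DiscreteGaloisModule
open Literature.NumberTheory.GaloisCohomology.Howard2004
open Literature.NumberTheory.EllipticCurves.CastellaGrossiLeeSkinner2022

/-! ## §1 The setting `(𝐓, 𝓕_Λ, 𝓛_E)` over the bare conductor equation (no `Thm413Hypotheses` record) -/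

section Setting

variable (N : ℕ) [NeZero N] (W : WeierstrassCurve ℚ) [W.IsElliptic] [W.IsGloballyMinimal] (K : Type) [Field K]
  [NumberField K] (p : ℕ) [hp : Fact p.Prime] (κ : ZpExtension K p)

/-- **The Selmer triple `(𝐓, 𝓕_Λ, 𝓛_E)` of §6 / Thm. 6.5.1 as Howard's tower data** — A2's `shapiroSettingTame` for
`E_K` at the twist `κ.unitTwist (-1)` (`Ψ⁻¹`), `S = {v ∣ pN}` with `N = N_E` the conductor (`hN`), `𝓛 = 𝓛_E`, the tame
finite–singular slots with pins `π` and guard `P`, and the caller's slots `jbar, cd, πbar, Dsrc`: the body of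
`CastellaGrossiLeeSkinner2022.thm411Setting` with `hyp.level` replaced by `hN` (no (Heeg), no (disc), no (h1) is read by
the setting).  Nothing is asserted about it.
[cite: CastellaGrossiSkinner2025, §6 standing and §6.1 ((𝐓, 𝓕_ord, 𝓛_E); final TeX l.2259–2262, v1 p0020 L10–L16, L50–L60)] [cite: CastellaGrossiLeeSkinner2022, §3.4 ((𝐓, 𝓕_Λ); arXiv v2 TeX L2083–2108)] [cite: Howard2004HeegnerKolyvagin, §2.2 Def. 2.2.3–2.2.6, Def. 1.1.8, Def. 1.2.3] -/
def thm651Setting (hN : N = W.conductorNorm ℤ) (jbar : AlgebraicClosure K →+* ℂ)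
    (π : ∀ v : HeightOneSpectrum (𝓞 K), TamePin v)
    (P : Finset (HeightOneSpectrum (𝓞 K)) → HeightOneSpectrum (𝓞 K) → Prop)
    (hP : ∀ j n v, P n v → TameHyp (fun n ↦ W.shapiroLevelQuot (κ.unitTwist (-1)) j n) n v)
    (cd : ConjugationDatum K)
    (πbar : letI := W.shapiroResidueModule K p
      ∀ j, W.ShapiroLevel K p j →ₗ[IwasawaAlgebra p ⧸ shapiroIdeal p (j + 1)] (W.baseChange K).geomTorsion (p : ℤ))
    (Dsrc : ∀ j, DualityDatum p cd ((W.shapiroTower K p (κ.unitTwist (-1))).ρ j) (IwasawaAlgebra p ⧸ shapiroIdeal p (j + 1))) :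
    letI := W.shapiroResidueModule K p
    CoeffTowerSetting p K (IwasawaAlgebra p) (W.ShapiroLevel K p) (fun j ↦ IwasawaAlgebra p ⧸ shapiroIdeal p (j + 1))
      ((W.baseChange K).geomTorsion (p : ℤ))
      (fun j n ↦ LevelData.QuotCarrier (IwasawaAlgebra p ⧸ shapiroIdeal p (j + 1))
        ((W.shapiroTower K p (κ.unitTwist (-1))).ρ j) n) :=
  W.shapiroSettingTame (κ.unitTwist (-1)) π P hP (placesDividing K (p * N) mul_level_ne_zero)
    (fun _ hv ↦ mem_placesDividing_of_dvd mul_level_ne_zero (dvd_mul_right p N) hv)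
    (fun _ hv _ ↦ hasGoodReductionAt_of_not_mem_placesDividing W hN mul_level_ne_zero hv)
    (heegnerKolyvaginPrimes W (κ.unitTwist (-1)) (placesDividing K (p * N) mul_level_ne_zero))
    (heegnerKolyvaginPrimes_subset_degreeTwoPrimes W (κ.unitTwist (-1)) _)
    (fun _ hv ↦ not_mem_of_mem_heegnerKolyvaginPrimes W (κ.unitTwist (-1)) _ hv) jbar cd πbar Dsrc

/-- **By-name glue with CGLS22 Thm. 4.1.1's setting**: `thm411Setting … hyp … = thm651Setting … hyp.level …`
definitionally — a Kolyvagin system `κ^{Hg}` delivered by `thm411_exists_kolyvaginSystem_one_ne_zero` IS a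
Kolyvagin system of `thm651Setting`, to which the fact below applies (this is the printed lead-in of Thm. 6.5.2:
«Applying Theorem 6.5.1 to the Kolyvagin system `κ^{Hg}` of [CGLS22]»).
[cite: CastellaGrossiSkinner2025, Thm. 6.5.2 lead-in (final TeX l.3229; v1 p0026 L42)] [cite: CastellaGrossiLeeSkinner2022, §3.4 and Thm. 4.1.1] -/
theorem thm411Setting_eq_thm651Setting {γ : Field.absoluteGaloisGroup K} (hyp : Thm413Hypotheses N W K p κ γ)
    (jbar : AlgebraicClosure K →+* ℂ) (π : ∀ v : HeightOneSpectrum (𝓞 K), TamePin v)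
    (P : Finset (HeightOneSpectrum (𝓞 K)) → HeightOneSpectrum (𝓞 K) → Prop)
    (hP : ∀ j n v, P n v → TameHyp (fun n ↦ W.shapiroLevelQuot (κ.unitTwist (-1)) j n) n v)
    (cd : ConjugationDatum K)
    (πbar : letI := W.shapiroResidueModule K p
      ∀ j, W.ShapiroLevel K p j →ₗ[IwasawaAlgebra p ⧸ shapiroIdeal p (j + 1)] (W.baseChange K).geomTorsion (p : ℤ))
    (Dsrc : ∀ j, DualityDatum p cd ((W.shapiroTower K p (κ.unitTwist (-1))).ρ j) (IwasawaAlgebra p ⧸ shapiroIdeal p (j + 1))) :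
    letI := W.shapiroResidueModule K p
    thm411Setting N W K p κ γ hyp jbar π P hP cd πbar Dsrc = thm651Setting N W K p κ hyp.level jbar π P hP cd πbar Dsrc :=
  rfl

end Setting

/-! ## §2 Theorem 6.5.1 as ONE named fact -/

section Fact

/-- **Castella–Grossi–Skinner, Math. Ann. 393 (2025) 2451–2506 = arXiv:2303.04373, Theorem 6.5.1** (`thm:howard`,
final TeX l.3213–3220; v1 Thm. 5.5.1, p0026 L27–L31), verbatim: "Assume `E(K)[p] = 0` and suppose there is a
Kolyvagin system `κ ∈ 𝐊𝐒(𝐓, 𝓕_Λ, 𝓛_E)` with `κ₁ ≠ 0`. Then `𝔖_ord(E/K_∞⁻)` has `Λ`-rank one, and there is a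
finitely generated torsion `Λ`-module `M` such that (i) `𝔛_ord(E/K_∞⁻) ∼ Λ ⊕ M ⊕ M`, (ii) `char_Λ(M)` divides
`char_Λ(𝔖_ord(E/K_∞⁻)/Λκ₁)` in `Λ[1/p]`" — under the §6 standing hypotheses ONLY (l.2259–2262: `E/ℚ` of
conductor `N`; `p ∤ 2N` of good ordinary reduction; `K` imaginary quadratic with `D_K` prime to `Np`; (h1)
`E(K)[p] = 0`; `Λ = Λ_K⁻`, `K_∞⁻/K` anticyclotomic): NO (Heeg), NO (disc), NO (spl), NO class-number, NO
Galois-image hypothesis beyond (h1), NO Selmer-corank hypothesis.  RECORDED AS: for the Selmer triple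
`(𝐓, 𝓕_Λ, 𝓛_E)` of `E_K` in Howard's tower form (`thm651Setting` = `CastellaGrossiLeeSkinner2022.thm411Setting` over
the bare conductor equation, by `rfl`), for every `Λ`-adic Selmer datum `D` (`𝔖_ord`), Selmer-dual datum `X`
(`𝔛_ord`), element `z : D.S`, every choice of the presentation slots (tame pins `π`; a guard `P` CONTAINING the
level pairs `λ ∈ n ∈ 𝓝(𝓛_E)`, where the finite–singular slots are Howard's comparison isomorphisms —
`thm411Setting_fsAdmissible` —; `cd`, `πbar`, `Dsrc`), and every Kolyvagin system `κ` of the setting (Howard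
Def. 1.2.3, tower form) with `κ.one ≠ 0` whose bottom class lies on the same `Λ`-line as `Φ′(z)`
(`∃ a, κ.one = a • Φ′(z)` and `∃ b, Φ′(z) = b • κ.one`, `• = smulFamily`, `Φ′ = toShapiroSuccLimitH1` x9-p2's
Shapiro comparison `𝔖 → lim_j H¹(K, 𝐓_j)`, Howard Def. 2.2.3 — so `Λκ₁ = Λ ∙ z` under the §6.5 identification
`H¹_{𝓕_Λ}(K, 𝐓) = 𝔖_ord`): `D.S` and `X.X` are finitely generated of `Λ`-rank one, and there are an ideal
`J ⊆ Λ` (`= char_Λ(M)`) and `m ∈ ℕ` with `char_Λ(𝔛_{Λ-tors}) = J²` ((i)) and `J ∣ (p^m) · char_Λ(D.S ⧸ Λ ∙ z)`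
((ii)) — the conclusion shape of the sibling `thm652_stabilized_rankOne_charIdeal_torsion_dvd_pLocalized` with
`Λκ₁^{Hg} = Λκ_∞(C)` replaced by the line of an ARBITRARY Kolyvagin system (WEAKER than print, never stronger).
PUBLISHED THEOREM (proof: [CGLS22] §3 + Thm. 6.1.1 of the paper at the prime `(γ⁻ - 1)`; no Heegner points).
A `Prop`; nothing asserted.
[cite: CastellaGrossiSkinner2025, Thm. 6.5.1 (final TeX `thm:howard` l.3213–3227; v1 Thm. 5.5.1, p0026 L27–L40) with §6 standing hypotheses (l.2259–2262; v1 p0020 L10–L16), §6.1 (𝐊𝐒(T, 𝓕_ord, 𝓛), v1 p0020 L50–L60) and §6.5 identifications (l.3201–3211; v1 p0026 L20–L25)]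
[cite: CastellaGrossiLeeSkinner2022, §3.1–§3.4 (𝐊𝐒, 𝓛_E, 𝐓, 𝓕_Λ; arXiv v2 TeX L1225–1311, L2083–2108), §3.2 standing (L1253–1262), Thm. 3.4.1]
[cite: Howard2004HeegnerKolyvagin, Def. 1.2.3 and §2.2 Def. 2.2.3–2.2.6 (arXiv:1202.6340 pp. 6–7, p0016)] -/
def thm651_rankOne_charIdeal_torsion_dvd_pLocalized_of_kolyvaginSystem : Prop :=
  ∀ (N : ℕ) [NeZero N] (W : WeierstrassCurve ℚ) [W.IsElliptic] [W.IsGloballyMinimal]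
    (K : Type) [Field K] [NumberField K] (p : ℕ) [Fact p.Prime] (κ : ZpExtension K p)
    (γ : Field.absoluteGaloisGroup K) (jbar : AlgebraicClosure K →+* ℂ)
    -- §6 standing hypotheses (final TeX l.2259–2262), field by field
    (hN : N = W.conductorNorm ℤ) (_hp2 : p ≠ 2) (_hord : IsOrdinaryAt W p) (_hK : IsImaginaryQuadratic K)
    (_hD : IsCoprime (NumberField.discr K) ((p * N : ℕ) : ℤ))
    (hE : ∀ Q : (W.baseChange K).toAffine.Point, p • Q = 0 → Q = 0)
    (_hac : κ.IsAnticyclotomic) (hγ : κ.IsTopGenerator γ)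
    -- `𝔖_ord`, `𝔛_ord`, and the class `κ₁ ∈ 𝔖_ord` as an element `z`
    (D : (W.baseChange K).LambdaAdicSelmerData κ γ) (X : (W.baseChange K).SelmerDualData κ γ) (z : D.S)
    -- presentation slots of the setting (as in the Thm. 4.1.1 fact)
    (π : ∀ v : HeightOneSpectrum (𝓞 K), TamePin v)
    (P : Finset (HeightOneSpectrum (𝓞 K)) → HeightOneSpectrum (𝓞 K) → Prop)
    (hP : ∀ j n v, P n v → TameHyp (fun n ↦ W.shapiroLevelQuot (κ.unitTwist (-1)) j n) n v)
    (_hPlev : ∀ n ∈ levels (heegnerKolyvaginPrimes W (κ.unitTwist (-1)) (placesDividing K (p * N) mul_level_ne_zero)),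
      ∀ v ∈ n, P n v)
    (cd : ConjugationDatum K),
    letI := W.shapiroResidueModule K p
    ∀ (πbar : ∀ j, W.ShapiroLevel K p j →ₗ[IwasawaAlgebra p ⧸ shapiroIdeal p (j + 1)] (W.baseChange K).geomTorsion (p : ℤ))
      (Dsrc : ∀ j, DualityDatum p cd ((W.shapiroTower K p (κ.unitTwist (-1))).ρ j)
        (IwasawaAlgebra p ⧸ shapiroIdeal p (j + 1)))
      -- «suppose there is a Kolyvagin system κ ∈ 𝐊𝐒(𝐓, 𝓕_Λ, 𝓛_E) with κ₁ ≠ 0», κ₁ on the Λ-line of Φ′(z)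
      (κKS : (thm651Setting N W K p κ hN jbar π P hP cd πbar Dsrc).KolyvaginSystem),
      κKS.one ≠ 0 →
      (∃ a : IwasawaAlgebra p, κKS.one =
        (W.shapiroTower K p (κ.unitTwist (-1))).smulFamily a (W.toShapiroSuccLimitH1 D hγ hE z).1) →
      (∃ b : IwasawaAlgebra p, (W.toShapiroSuccLimitH1 D hγ hE z).1 =
        (W.shapiroTower K p (κ.unitTwist (-1))).smulFamily b κKS.one) →
      -- «Then 𝔖_ord has Λ-rank one, and … (i) 𝔛_ord ∼ Λ ⊕ M ⊕ M, (ii) char(M) ∣ char(𝔖_ord/Λκ₁) in Λ[1/p]»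
      (Module.Finite (IwasawaAlgebra p) D.S ∧ Module.finrank (IwasawaAlgebra p) D.S = 1) ∧
      (Module.Finite (IwasawaAlgebra p) X.X ∧ Module.finrank (IwasawaAlgebra p) X.X = 1 ∧
        ∃ (J : Ideal (IwasawaAlgebra p)) (m : ℕ),
          Module.charIdeal (IwasawaAlgebra p) (Submodule.torsion (IwasawaAlgebra p) X.X) = J ^ 2 ∧
          J ∣ Ideal.span {(p : IwasawaAlgebra p) ^ m} *
            Module.charIdeal (IwasawaAlgebra p) (D.S ⧸ Submodule.span (IwasawaAlgebra p) {z}))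

end Fact

end Literature.NumberTheory.EllipticCurves.CastellaGrossiSkinner2025

end
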